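import Summits.CriticalPhenomena.SAWScalingLimit.Theorems.SAWReversalUpgradeAttachNoReturnStructure
import HarnessLib

/-!
# Route `SAWReversalUpgrade`, support `AttachNoReturn` (stmt-CriticalPhenomena-18057):
# endpoint events of a standard attachment are events of the pushed polyline

Helper file for the proof of
`Summit.CriticalPhenomena.SAWScalingLimit.Theses.SAWReversalUpgrade.AttachNoReturn`.

Deterministic core of the support item, for ONE standard attachment `c` of ONE flat curve in the
non-degenerate case `uMid < vMid`, under the separation hypotheses of `standard_order`
(head within `ρa` of `a`, tail within `ρb` of `b`, `ρa + ρb < dist a b`):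

* `event_pt_zero` — if `c` is `ε`-far from `a` at time `s` and `r`-close to `a` at a later
  time `t`, with `ρa < ε` and `r + ρb < dist a b`, then both points are values of the pushed
  polyline `attZ` at parameters `x < y` of `[0, 1]` (in this order);
* `event_pt_one` — if `c` is `r`-close to `b` at time `s` and `ε`-far from `b` at a later time
  `t`, with `ρb < ε` and `r + ρa < dist a b`, the same conclusion.

Both are read off the traversal order `standard_order` (head first, middle piece in the order of
`attZ`, tail last) by the triangle inequality.
-/

noncomputable section

open Set Filter Metric Complex Function
open scoped Topology unitInterval
open UpperHalfPlane (upperHalfPlaneSet)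
open Literature.Probability.RandomPlanarGeometry

namespace Summit.CriticalPhenomena.SAWScalingLimit.Theorems

namespace AttachNoReturn

open AttachReversal FaithfulAttach

variable {D : DobrushinDomain} {φ : ConformalEquiv upperHalfPlaneSet D.carrier} {e : ℝ}
  {P : C(I, ℂ)} {R : ℝ → ℂ} {ρa ρb : ℝ}

section Events

variable (hφ : D.IsChordalUniformizing φ) (he0 : 0 < e) (he1 : e ≤ 1 / 2)
  (hR : ∀ u, R u = P (projIcc 0 1 zero_le_one u))
  (hPcl : ∀ t, P t ∈ closure D.carrier) (hP0 : P 0 ∈ D.carrier) (hP1 : P 1 ∈ D.carrier)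
  (hρa : ∀ z : ℂ, 0 ≤ z.im → ‖z‖ ≤ ‖hinv φ.boundaryExtension (P 0)‖ →
    dist (φ.boundaryExtension z) (D.pt 0) ≤ ρa)
  (hρb : ∀ z : ℂ, 0 ≤ z.im → ‖hinv φ.boundaryExtension (P 1)‖ ≤ ‖z‖ →
    dist (φ.boundaryExtension z) (D.pt 1) ≤ ρb)
  (hsep : ρa + ρb < dist (D.pt 0) (D.pt 1))
  (hflat : ∀ s t : I, P s = P t → ∀ w : I, s ≤ w → w ≤ t → P w = P s)
  {c : Curve ℂ} (hc : c ∈ standardCurves (D.pt 0) (D.pt 1) φ.boundaryExtension e R D.carrier)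
  (huv : uMid (D.pt 0) (D.pt 1) φ.boundaryExtension e R < vMid (D.pt 0) (D.pt 1) φ.boundaryExtension e R)

include hφ he0 he1 hR hPcl hP0 hP1 hρa hρb hsep hflat hc huv

/-- **A deep return of the attached curve to `a` is a deep return of the pushed polyline**
(in the same order): the far point and the later near point are both on the middle piece, at
parameters `x < y`. -/
theorem event_pt_zero {ε r : ℝ} (hρε : ρa < ε) (hr : r + ρb < dist (D.pt 0) (D.pt 1))
    {s t : I} (hst : s < t) (hfar : ε ≤ dist (c s) (D.pt 0)) (hnear : dist (c t) (D.pt 0) ≤ r) :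
    ∃ x ∈ Icc (0 : ℝ) 1, ∃ y ∈ Icc (0 : ℝ) 1, x < y ∧
      attZ (D.pt 1) φ.boundaryExtension e R x = c s ∧ attZ (D.pt 1) φ.boundaryExtension e R y = c t := by
  obtain ⟨hIuv, ta, tb, -, -, -, hA4, hA5, hA6, hA7, hmid, hA8⟩ :=
    standard_order hφ he0 he1 hR hPcl hP0 hP1 hρa hρb hsep hflat hc huv
  have ht_lt : t < tb := by
    by_contra h
    rw [not_lt] at h
    have h1 := hA7 t h
    have h2 := dist_triangle (D.pt 0) (c t) (D.pt 1)
    rw [dist_comm (D.pt 0) (c t)] at h2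
    linarith
  have ht_gt : ta < t := by
    by_contra h
    rw [not_lt] at h
    have := hA4 s (lt_of_lt_of_le hst h)
    linarith
  have hs_gt : ta < s := by
    by_contra h
    rw [not_lt] at h
    have := hA6 s h
    linarith
  obtain ⟨x, hx, y, hy, hxy, hZx, hZy⟩ :=
    hA8 s t hst (hmid s hs_gt (hst.trans ht_lt)) (hmid t ht_gt ht_lt)
  exact ⟨x, hIuv hx, y, hIuv hy, hxy, hZx, hZy⟩

/-- **An escape of the attached curve from `b` after a close approach is one of the pushed
polyline** (in the same order): the near point and the later far point are both on the middle
piece, at parameters `x < y`. -/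
theorem event_pt_one {ε r : ℝ} (hρε : ρb < ε) (hr : r + ρa < dist (D.pt 0) (D.pt 1))
    {s t : I} (hst : s < t) (hnear : dist (c s) (D.pt 1) ≤ r) (hfar : ε ≤ dist (c t) (D.pt 1)) :
    ∃ x ∈ Icc (0 : ℝ) 1, ∃ y ∈ Icc (0 : ℝ) 1, x < y ∧
      attZ (D.pt 1) φ.boundaryExtension e R x = c s ∧ attZ (D.pt 1) φ.boundaryExtension e R y = c t := by
  obtain ⟨hIuv, ta, tb, -, -, -, hA4, hA5, hA6, hA7, hmid, hA8⟩ :=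
    standard_order hφ he0 he1 hR hPcl hP0 hP1 hρa hρb hsep hflat hc huv
  have hs_gt : ta < s := by
    by_contra h
    rw [not_lt] at h
    have h1 := hA6 s h
    have h2 := dist_triangle (D.pt 0) (c s) (D.pt 1)
    rw [dist_comm (D.pt 0) (c s)] at h2
    linarith
  have ht_lt : t < tb := by
    by_contra h
    rw [not_lt] at h
    have := hA7 t h
    linarith
  have hs_lt : s < tb := hst.trans ht_lt
  obtain ⟨x, hx, y, hy, hxy, hZx, hZy⟩ :=
    hA8 s t hst (hmid s hs_gt hs_lt) (hmid t (hs_gt.trans hst) ht_lt)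
  exact ⟨x, hIuv hx, y, hIuv hy, hxy, hZx, hZy⟩

end Events

end AttachNoReturn

end Summit.CriticalPhenomena.SAWScalingLimit.Theorems
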